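import Mathlib
import HarnessLib
import Summits.AtomisticToContinuum.Crystallization.Theorems.HolmgrenBoyleLindHalfSpaceUniqueContinuationLayerSlices
import Summits.AtomisticToContinuum.Crystallization.Theorems.HolmgrenBoyleLindHalfSpaceUniqueContinuationLayerOrbits
import Summits.AtomisticToContinuum.Crystallization.Theorems.HolmgrenBoyleLindHalfSpaceUniqueContinuationVerticalModeLaplace
import Summits.AtomisticToContinuum.Crystallization.Theorems.HolmgrenBoyleLindHalfSpaceUniqueContinuationMomentsToFibres
import Summits.AtomisticToContinuum.Crystallization.Theorems.HolmgrenBoyleLindHalfSpaceUniqueContinuationNormalLineModes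

/-!
# Route `HolmgrenBoyleLind`: Lennard-Jones force fields of separated sources, part 17a —
INTERFACE RIGIDITY I: arithmetic observers kill every fibre of every mode

Support file for the crux item stmt-AtomisticToContinuum-6075 (`HalfSpaceUniqueContinuation`, line
`registered`, layered core, first THIN-column theorem; written by lead c3). SETTING: a unit normal
`u`, a rank-2 lattice `Λ` of the plane `W = (ℝ ∙ u)ᗮ`, and a SIGNED, `Λ`-invariant, `δ`-separated
source `(Dp, +), (Dm, −)` in the closed half-space `{⟪y, u⟫ ≥ a}` (the two defect sets of a pair
of half-space-agreeing equilibria). The geometric glue of the line's analytic machinery: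

* `hbl_echar_nsmul`, `hbl_dualVec_zero`, `hbl_exists_norm_dualVec_lb` — small facts on the torus
  characters `e_k` and dual vectors `w_k = dualVec Λ k` of part P1;
* **`hbl_fibres_eq_zero_of_arith_observers'`** (+ registered `∀`-form
  `hbl_fibres_eq_zero_of_arith_observers`) — if the vertical component of the signed field
  vanishes at the observers `x₀ + nγ` (`n ∈ ℕ`, `⟪x₀, u⟫ < a`, `⟪γ, u⟫ < 0`) and the registry step
  character `k ↦ e_k(Pγ)` is injective, then every height fibre of every signed structure factor
  `∑_{q ∈ T} ε_q e_{−k}(P q)` vanishes. Proof: the mode expansion on horizontal planes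
  (`hbl_signedField_hasSum_modes'`, part 14) at the observers, with the vertical profiles of part 15
  (`hbl_fourier_verticalSlice(_zero)`), is literally the moment hypothesis of the hedgehog core
  `hbl_fibres_eq_zero_of_modeMoments'` (part 16).
All `[folklore]`; nothing here closes an item.
-/

noncomputable section

namespace Summit.AtomisticToContinuum.Crystallization.Theorems.HolmgrenBoyleLind

open scoped BigOperators Topology InnerProductSpace RealInnerProductSpace FourierTransform
open MeasureTheory Filter Set Literature.Algebra.EuclideanLattices.LatticePeriodic
  Literature.Analysis.SpecialFunctions
open scoped Classical

/-! ## Auxiliary lemmas -/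

section Aux

variable {u : EuclideanSpace ℝ (Fin 3)} (Λ : Submodule ℤ (ℝ ∙ u)ᗮ) [DiscreteTopology Λ]
  [IsZLattice ℝ Λ]

/-- Characters of multiples: `e_k(n • v) = e_k(v)ⁿ`. [folklore] -/
theorem hbl_echar_nsmul (k : Fin (Module.finrank ℝ (ℝ ∙ u)ᗮ) → ℤ) (v : (ℝ ∙ u)ᗮ) (n : ℕ) :
    echar Λ k ((n : ℝ) • v) = echar Λ k v ^ n := by
  induction n with
  | zero => simp [zero_smul, echar, map_zero]
  | succ n ih =>
    rw [Nat.cast_succ, add_smul, one_smul, echar_add, ih, pow_succ]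

/-- The zero frequency has zero dual vector. [folklore] -/
theorem hbl_dualVec_zero : dualVec Λ (0 : Fin (Module.finrank ℝ (ℝ ∙ u)ᗮ) → ℤ) = 0 := by
  have h := dualVec_add Λ 0 0
  rw [add_zero] at h
  -- `d = d + d` forces `d = 0`
  have h2 : dualVec Λ (0 : Fin (Module.finrank ℝ (ℝ ∙ u)ᗮ) → ℤ) +
      dualVec Λ (0 : Fin (Module.finrank ℝ (ℝ ∙ u)ᗮ) → ℤ) =
      dualVec Λ (0 : Fin (Module.finrank ℝ (ℝ ∙ u)ᗮ) → ℤ) + 0 := by rw [add_zero]; exact h.symm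
  exact add_left_cancel h2

/-- A uniform lower bound for the norms of the non-zero dual vectors. [folklore] -/
theorem hbl_exists_norm_dualVec_lb :
    ∃ κ : ℝ, 0 < κ ∧ ∀ k : Fin (Module.finrank ℝ (ℝ ∙ u)ᗮ) → ℤ, k ≠ 0 → κ ≤ ‖dualVec Λ k‖ := by
  classical
  have hfin := finite_norm_dualVec_le Λ 1
  -- the finitely many non-zero frequencies of norm ≤ 1 have positive norms
  set S : Finset (Fin (Module.finrank ℝ (ℝ ∙ u)ᗮ) → ℤ) := hfin.toFinset.erase 0 with hS
  by_cases hne : S.Nonempty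
  · obtain ⟨k₀, hk₀, hmin⟩ := S.exists_min_image (fun k => ‖dualVec Λ k‖) hne
    have hk₀ne : k₀ ≠ 0 := (Finset.mem_erase.1 hk₀).1
    have hpos : 0 < ‖dualVec Λ k₀‖ := by
      rw [norm_pos_iff]
      intro h0
      exact hk₀ne (dualVec_injective Λ (h0.trans (hbl_dualVec_zero Λ).symm))
    refine ⟨min 1 ‖dualVec Λ k₀‖, lt_min one_pos hpos, fun k hk => ?_⟩
    by_cases hk1 : ‖dualVec Λ k‖ ≤ 1
    · have hkS : k ∈ S := Finset.mem_erase.2 ⟨hk, hfin.mem_toFinset.2 hk1⟩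
      exact (min_le_right _ _).trans (hmin k hkS)
    · exact (min_le_left _ _).trans (le_of_lt (not_le.1 hk1))
  · refine ⟨1, one_pos, fun k hk => ?_⟩
    by_contra h1
    exact hne ⟨k, Finset.mem_erase.2 ⟨hk, hfin.mem_toFinset.2 (le_of_lt (not_le.1 h1))⟩⟩

end Aux

/-! ## The geometric glue: arithmetic observers empty a signed lattice-invariant source -/

section Glue

variable {u : EuclideanSpace ℝ (Fin 3)} (hu : ‖u‖ = 1) (Λ : Submodule ℤ (ℝ ∙ u)ᗮ)
  [DiscreteTopology Λ] [IsZLattice ℝ Λ] {Dp Dm : Set (EuclideanSpace ℝ (Fin 3))} {δ a : ℝ}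
  (hδ : 0 < δ) (hdisj : Disjoint Dp Dm)
  (hsepp : ∀ x ∈ Dp, ∀ y ∈ Dp, x ≠ y → δ ≤ dist x y)
  (hsepm : ∀ x ∈ Dm, ∀ y ∈ Dm, x ≠ y → δ ≤ dist x y)
  (hap : ∀ y ∈ Dp, a ≤ ⟪y, u⟫) (ham : ∀ y ∈ Dm, a ≤ ⟪y, u⟫)
  (hDp : ∀ ℓ : Λ, ∀ y : EuclideanSpace ℝ (Fin 3),
    y + ((ℓ : (ℝ ∙ u)ᗮ) : EuclideanSpace ℝ (Fin 3)) ∈ Dp ↔ y ∈ Dp)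
  (hDm : ∀ ℓ : Λ, ∀ y : EuclideanSpace ℝ (Fin 3),
    y + ((ℓ : (ℝ ∙ u)ᗮ) : EuclideanSpace ℝ (Fin 3)) ∈ Dm ↔ y ∈ Dm)

set_option maxHeartbeats 1600000 in
include hu hδ hsepp hsepm hap ham hDp hDm in
/-- **Arithmetic observers kill every fibre of every mode.** If the vertical component of the
signed field vanishes at the points `x₀ + n γ` (`n ∈ ℕ`) of an arithmetic progression descending
from below the plane (`⟪x₀, u⟫ < a`, `⟪γ, u⟫ < 0`) whose registry step character `k ↦ e_k(P γ)` is
injective, then for every frequency `k` and every height `η` the signed structure factor of the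
representatives at height `η` vanishes. [folklore] -/
theorem hbl_fibres_eq_zero_of_arith_observers' (x₀ γ : EuclideanSpace ℝ (Fin 3))
    (hx₀ : ⟪x₀, u⟫ < a) (hγ : ⟪γ, u⟫ < 0)
    (hinj : Function.Injective fun k : Fin (Module.finrank ℝ (ℝ ∙ u)ᗮ) → ℤ =>
      echar Λ k ((ℝ ∙ u)ᗮ.orthogonalProjectionOnto γ))
    (hobs : ∀ n : ℕ,
      (∑' yy : ↥(Dp ∪ Dm), (if (yy : EuclideanSpace ℝ (Fin 3)) ∈ Dp then (1 : ℂ) else -1) *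
        ((⟪u, ((((‖(x₀ + (n : ℝ) • γ) - (yy : EuclideanSpace ℝ (Fin 3))‖ ^ 2) ^ 4)⁻¹ -
            ((‖(x₀ + (n : ℝ) • γ) - (yy : EuclideanSpace ℝ (Fin 3))‖ ^ 2) ^ 7)⁻¹) •
              ((x₀ + (n : ℝ) • γ) - (yy : EuclideanSpace ℝ (Fin 3))))⟫ : ℝ) : ℂ)) = 0) :
    ∀ (k : Fin (Module.finrank ℝ (ℝ ∙ u)ᗮ) → ℤ) (η : ℝ)
      (T : Finset {q : EuclideanSpace ℝ (Fin 3) //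
        q ∈ Dp ∪ Dm ∧ (ℝ ∙ u)ᗮ.orthogonalProjectionOnto q ∈ fdom Λ}),
      (∀ q, q ∈ T ↔ ⟪(q : EuclideanSpace ℝ (Fin 3)), u⟫ = η) →
      ∑ q ∈ T, (if ((q : EuclideanSpace ℝ (Fin 3)) ∈ Dp) then (1 : ℂ) else -1) *
        echar Λ (-k) ((ℝ ∙ u)ᗮ.orthogonalProjectionOnto (q : EuclideanSpace ℝ (Fin 3))) = 0 := by
  classical
  intro k η T hT
  -- the index type of representatives, heights, window count
  haveI hR : Countable {q : EuclideanSpace ℝ (Fin 3) //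
      q ∈ Dp ∪ Dm ∧ (ℝ ∙ u)ᗮ.orthogonalProjectionOnto q ∈ fdom Λ} :=
    hbl_countable_signedReps Λ hδ hsepp hsepm
  have hy : ∀ q : {q : EuclideanSpace ℝ (Fin 3) //
      q ∈ Dp ∪ Dm ∧ (ℝ ∙ u)ᗮ.orthogonalProjectionOnto q ∈ fdom Λ},
      0 ≤ ⟪(q : EuclideanSpace ℝ (Fin 3)), u⟫ - a := by
    intro q
    rcases q.2.1 with h | h
    · linarith [hap _ h]
    · linarith [ham _ h]
  obtain ⟨N, hNc⟩ := hbl_exists_reps_height_count hu Λ hδ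
  have hN : ∀ j : ℕ, {q : {q : EuclideanSpace ℝ (Fin 3) //
      q ∈ Dp ∪ Dm ∧ (ℝ ∙ u)ᗮ.orthogonalProjectionOnto q ∈ fdom Λ} |
        (j : ℝ) ≤ ⟪(q : EuclideanSpace ℝ (Fin 3)), u⟫ - a ∧
          ⟪(q : EuclideanSpace ℝ (Fin 3)), u⟫ - a ≤ j + 1}.encard ≤ (N + N : ℕ) := by
    intro j
    set A := {q : {q : EuclideanSpace ℝ (Fin 3) //
      q ∈ Dp ∪ Dm ∧ (ℝ ∙ u)ᗮ.orthogonalProjectionOnto q ∈ fdom Λ} |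
        (j : ℝ) ≤ ⟪(q : EuclideanSpace ℝ (Fin 3)), u⟫ - a ∧
          ⟪(q : EuclideanSpace ℝ (Fin 3)), u⟫ - a ≤ j + 1} with hA
    have himg : (Subtype.val '' A) ⊆
        {q : EuclideanSpace ℝ (Fin 3) | (q ∈ Dp ∧ (ℝ ∙ u)ᗮ.orthogonalProjectionOnto q ∈ fdom Λ) ∧
          (a + j) ≤ ⟪q, u⟫ ∧ ⟪q, u⟫ ≤ (a + j) + 1} ∪
        {q : EuclideanSpace ℝ (Fin 3) | (q ∈ Dm ∧ (ℝ ∙ u)ᗮ.orthogonalProjectionOnto q ∈ fdom Λ) ∧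
          (a + j) ≤ ⟪q, u⟫ ∧ ⟪q, u⟫ ≤ (a + j) + 1} := by
      rintro x ⟨q, ⟨h1, h2⟩, rfl⟩
      rcases q.2.1 with h | h
      · exact Or.inl ⟨⟨h, q.2.2⟩, by linarith, by linarith⟩
      · exact Or.inr ⟨⟨h, q.2.2⟩, by linarith, by linarith⟩
    calc A.encard = (Subtype.val '' A).encard := (Subtype.val_injective.encard_image A).symm
      _ ≤ _ := Set.encard_le_encard himg
      _ ≤ _ := Set.encard_union_le _ _
      _ ≤ (N : ℕ∞) + N := add_le_add (hNc Dp hsepp (a + j)) (hNc Dm hsepm (a + j))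
      _ = ((N + N : ℕ) : ℕ∞) := by push_cast; rfl
  -- frequency data
  have hu0 : u ≠ 0 := by
    intro h0; rw [h0, norm_zero] at hu; exact zero_ne_one hu
  have hV : Module.finrank ℝ (ℝ ∙ u)ᗮ = 2 := hbl_finrank_orthogonal_span_singleton hu0
  obtain ⟨κ, hκ, hκle⟩ := hbl_exists_norm_dualVec_lb Λ
  have hρ0 : ‖dualVec Λ (0 : Fin (Module.finrank ℝ (ℝ ∙ u)ᗮ) → ℤ)‖ = 0 := by
    rw [hbl_dualVec_zero, norm_zero]
  have hρ : ∀ k : Fin (Module.finrank ℝ (ℝ ∙ u)ᗮ) → ℤ, k ≠ 0 → 0 < ‖dualVec Λ k‖ :=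
    fun k hk => hκ.trans_le (hκle k hk)
  have hfin : ∀ C : ℝ, {k : Fin (Module.finrank ℝ (ℝ ∙ u)ᗮ) → ℤ | ‖dualVec Λ k‖ ≤ C}.Finite :=
    fun C => finite_norm_dualVec_le Λ C
  have hexp : ∀ ε : ℝ, 0 < ε →
      Summable fun k : Fin (Module.finrank ℝ (ℝ ∙ u)ᗮ) → ℤ => Real.exp (-(ε * ‖dualVec Λ k‖)) :=
    fun ε hε => (summable_exp_neg_mul_norm_dualVec Λ hε).congr fun k => by ring_nf
  have hχ : ∀ k : Fin (Module.finrank ℝ (ℝ ∙ u)ᗮ) → ℤ,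
      ‖echar Λ k ((ℝ ∙ u)ᗮ.orthogonalProjectionOnto γ)‖ = 1 := fun k => norm_echar Λ k _
  have hψ : ∀ k : Fin (Module.finrank ℝ (ℝ ∙ u)ᗮ) → ℤ,
      ‖echar Λ k ((ℝ ∙ u)ᗮ.orthogonalProjectionOnto x₀)‖ = 1 := fun k => norm_echar Λ k _
  have hθ : ∀ (k : Fin (Module.finrank ℝ (ℝ ∙ u)ᗮ) → ℤ)
      (q : {q : EuclideanSpace ℝ (Fin 3) //
        q ∈ Dp ∪ Dm ∧ (ℝ ∙ u)ᗮ.orthogonalProjectionOnto q ∈ fdom Λ}),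
      ‖(if ((q : EuclideanSpace ℝ (Fin 3)) ∈ Dp) then (1 : ℂ) else -1) *
        echar Λ (-k) ((ℝ ∙ u)ᗮ.orthogonalProjectionOnto (q : EuclideanSpace ℝ (Fin 3)))‖ ≤ 1 := by
    intro k q
    rw [norm_mul, norm_echar, mul_one]
    split_ifs <;> simp
  have hθ0 : ∀ q : {q : EuclideanSpace ℝ (Fin 3) //
        q ∈ Dp ∪ Dm ∧ (ℝ ∙ u)ᗮ.orthogonalProjectionOnto q ∈ fdom Λ},
      (if ((q : EuclideanSpace ℝ (Fin 3)) ∈ Dp) then (1 : ℂ) else -1) *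
        echar Λ (-0) ((ℝ ∙ u)ᗮ.orthogonalProjectionOnto (q : EuclideanSpace ℝ (Fin 3))) = 1 ∨
      (if ((q : EuclideanSpace ℝ (Fin 3)) ∈ Dp) then (1 : ℂ) else -1) *
        echar Λ (-0) ((ℝ ∙ u)ᗮ.orthogonalProjectionOnto (q : EuclideanSpace ℝ (Fin 3))) = -1 := by
    intro q
    rw [neg_zero, echar_zero, mul_one]
    split_ifs
    · exact Or.inl rfl
    · exact Or.inr rfl
  have hh : 0 < -⟪γ, u⟫ := by linarith
  have hX₀ : 0 < a - ⟪x₀, u⟫ := by linarith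
  -- the moment identities along the observers
  have hmom : ∀ n : ℕ, HasSum (fun k : Fin (Module.finrank ℝ (ℝ ∙ u)ᗮ) → ℤ =>
      echar Λ k ((ℝ ∙ u)ᗮ.orthogonalProjectionOnto x₀) *
        echar Λ k ((ℝ ∙ u)ᗮ.orthogonalProjectionOnto γ) ^ n *
      ∑' q : {q : EuclideanSpace ℝ (Fin 3) //
          q ∈ Dp ∪ Dm ∧ (ℝ ∙ u)ᗮ.orthogonalProjectionOnto q ∈ fdom Λ},
        ((if ((q : EuclideanSpace ℝ (Fin 3)) ∈ Dp) then (1 : ℂ) else -1) *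
          echar Λ (-k) ((ℝ ∙ u)ᗮ.orthogonalProjectionOnto (q : EuclideanSpace ℝ (Fin 3)))) *
        (if k = 0 then
          ((-(Real.pi * (((a - ⟪x₀, u⟫) + n * (-⟪γ, u⟫) + (⟪(q : EuclideanSpace ℝ (Fin 3)), u⟫ - a))⁻¹ ^ 5 / 3 -
            ((a - ⟪x₀, u⟫) + n * (-⟪γ, u⟫) + (⟪(q : EuclideanSpace ℝ (Fin 3)), u⟫ - a))⁻¹ ^ 11 / 6)) : ℝ) : ℂ)
        else
          ((-(Real.pi / 6 * (Real.pi * ‖dualVec Λ k‖) ^ 3) *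
              ((((a - ⟪x₀, u⟫) + n * (-⟪γ, u⟫) + (⟪(q : EuclideanSpace ℝ (Fin 3)), u⟫ - a)) ^ (-(2 : ℝ)) : ℝ) *
                ∫ w : ℝ, Real.exp (3 * w - 2 * Real.pi * ‖dualVec Λ k‖ *
                  ((a - ⟪x₀, u⟫) + n * (-⟪γ, u⟫) + (⟪(q : EuclideanSpace ℝ (Fin 3)), u⟫ - a)) * Real.cosh w)) +
            (Real.pi / 720 * (Real.pi * ‖dualVec Λ k‖) ^ 6) *
              ((((a - ⟪x₀, u⟫) + n * (-⟪γ, u⟫) + (⟪(q : EuclideanSpace ℝ (Fin 3)), u⟫ - a)) ^ (-(5 : ℝ)) : ℝ) *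
                ∫ w : ℝ, Real.exp (6 * w - 2 * Real.pi * ‖dualVec Λ k‖ *
                  ((a - ⟪x₀, u⟫) + n * (-⟪γ, u⟫) + (⟪(q : EuclideanSpace ℝ (Fin 3)), u⟫ - a)) * Real.cosh w)) :
            ℝ) : ℂ))) 0 := by
    intro n
    have hXn : 0 < (a - ⟪x₀, u⟫) + n * (-⟪γ, u⟫) :=
      add_pos_of_pos_of_nonneg hX₀ (mul_nonneg (Nat.cast_nonneg n) hh.le)
    set bn : (ℝ ∙ u)ᗮ := (ℝ ∙ u)ᗮ.orthogonalProjectionOnto x₀ +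
      (n : ℝ) • (ℝ ∙ u)ᗮ.orthogonalProjectionOnto γ with hbn
    have hz : x₀ + (n : ℝ) • γ =
        (bn : EuclideanSpace ℝ (Fin 3)) + (a - ((a - ⟪x₀, u⟫) + n * (-⟪γ, u⟫))) • u := by
      have h1 := hbl_eq_proj_add_inner_smul hu (x₀ + (n : ℝ) • γ)
      rw [map_add, map_smul, inner_add_left, real_inner_smul_left] at h1
      have hcoef : ⟪x₀, u⟫ + (n : ℝ) * ⟪γ, u⟫ = a - ((a - ⟪x₀, u⟫) + n * (-⟪γ, u⟫)) := by ring
      rw [hbn, ← hcoef]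
      exact h1
    have H := hbl_signedField_hasSum_modes' hu Λ hδ hsepp hsepm hap ham hDp hDm u bn hXn
      _ hz
    rw [hobs n] at H
    have hcov : (volume.real (fdom Λ)) ≠ 0 := (measureReal_fdom_pos Λ volume).ne'
    have H2 := H.mul_left (((volume.real (fdom Λ)) : ℝ) : ℂ)
    rw [mul_zero] at H2
    refine H2.congr_fun fun k => ?_
    -- the character of the observer base point
    have hchar : echar Λ k bn = echar Λ k ((ℝ ∙ u)ᗮ.orthogonalProjectionOnto x₀) *
        echar Λ k ((ℝ ∙ u)ᗮ.orthogonalProjectionOnto γ) ^ n := by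
      rw [hbn, echar_add, hbl_echar_nsmul]
    -- the slice of the vertical component and its transform
    have hPu : (ℝ ∙ u)ᗮ.orthogonalProjectionOnto u = 0 :=
      Submodule.orthogonalProjectionOnto_orthogonalComplement_singleton_eq_zero u
    have huu : ⟪u, u⟫ = 1 := by rw [real_inner_self_eq_norm_sq, hu, one_pow]
    have hterm : ∀ q : {q : EuclideanSpace ℝ (Fin 3) //
        q ∈ Dp ∪ Dm ∧ (ℝ ∙ u)ᗮ.orthogonalProjectionOnto q ∈ fdom Λ},
        𝓕 (fun v : (ℝ ∙ u)ᗮ =>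
          ((((⟪(ℝ ∙ u)ᗮ.orthogonalProjectionOnto u, v⟫ +
                (-((a - ⟪x₀, u⟫) + n * (-⟪γ, u⟫) +
                  (⟪(q : EuclideanSpace ℝ (Fin 3)), u⟫ - a))) * ⟪u, u⟫) *
              ((‖v‖ ^ 2 + (-((a - ⟪x₀, u⟫) + n * (-⟪γ, u⟫) +
                  (⟪(q : EuclideanSpace ℝ (Fin 3)), u⟫ - a))) ^ 2) ^ (-(4 : ℝ)) -
                (‖v‖ ^ 2 + (-((a - ⟪x₀, u⟫) + n * (-⟪γ, u⟫) +
                  (⟪(q : EuclideanSpace ℝ (Fin 3)), u⟫ - a))) ^ 2) ^ (-(7 : ℝ)))) : ℝ) : ℂ))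
            (dualVec Λ k) =
        (if k = 0 then
          ((-(Real.pi * (((a - ⟪x₀, u⟫) + n * (-⟪γ, u⟫) +
              (⟪(q : EuclideanSpace ℝ (Fin 3)), u⟫ - a))⁻¹ ^ 5 / 3 -
            ((a - ⟪x₀, u⟫) + n * (-⟪γ, u⟫) +
              (⟪(q : EuclideanSpace ℝ (Fin 3)), u⟫ - a))⁻¹ ^ 11 / 6)) : ℝ) : ℂ)
        else
          ((-(Real.pi / 6 * (Real.pi * ‖dualVec Λ k‖) ^ 3) *
              ((((a - ⟪x₀, u⟫) + n * (-⟪γ, u⟫) +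
                  (⟪(q : EuclideanSpace ℝ (Fin 3)), u⟫ - a)) ^ (-(2 : ℝ)) : ℝ) *
                ∫ w : ℝ, Real.exp (3 * w - 2 * Real.pi * ‖dualVec Λ k‖ *
                  ((a - ⟪x₀, u⟫) + n * (-⟪γ, u⟫) +
                    (⟪(q : EuclideanSpace ℝ (Fin 3)), u⟫ - a)) * Real.cosh w)) +
            (Real.pi / 720 * (Real.pi * ‖dualVec Λ k‖) ^ 6) *
              ((((a - ⟪x₀, u⟫) + n * (-⟪γ, u⟫) +
                  (⟪(q : EuclideanSpace ℝ (Fin 3)), u⟫ - a)) ^ (-(5 : ℝ)) : ℝ) *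
                ∫ w : ℝ, Real.exp (6 * w - 2 * Real.pi * ‖dualVec Λ k‖ *
                  ((a - ⟪x₀, u⟫) + n * (-⟪γ, u⟫) +
                    (⟪(q : EuclideanSpace ℝ (Fin 3)), u⟫ - a)) * Real.cosh w)) :
            ℝ) : ℂ)) := by
      intro q
      have ht : 0 < (a - ⟪x₀, u⟫) + n * (-⟪γ, u⟫) + (⟪(q : EuclideanSpace ℝ (Fin 3)), u⟫ - a) :=
        add_pos_of_pos_of_nonneg hXn (hy q)
      have hfun : (fun v : (ℝ ∙ u)ᗮ =>
          ((((⟪(ℝ ∙ u)ᗮ.orthogonalProjectionOnto u, v⟫ +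
                (-((a - ⟪x₀, u⟫) + n * (-⟪γ, u⟫) +
                  (⟪(q : EuclideanSpace ℝ (Fin 3)), u⟫ - a))) * ⟪u, u⟫) *
              ((‖v‖ ^ 2 + (-((a - ⟪x₀, u⟫) + n * (-⟪γ, u⟫) +
                  (⟪(q : EuclideanSpace ℝ (Fin 3)), u⟫ - a))) ^ 2) ^ (-(4 : ℝ)) -
                (‖v‖ ^ 2 + (-((a - ⟪x₀, u⟫) + n * (-⟪γ, u⟫) +
                  (⟪(q : EuclideanSpace ℝ (Fin 3)), u⟫ - a))) ^ 2) ^ (-(7 : ℝ)))) : ℝ) : ℂ)) =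
          fun v : (ℝ ∙ u)ᗮ => (((-((a - ⟪x₀, u⟫) + n * (-⟪γ, u⟫) +
                  (⟪(q : EuclideanSpace ℝ (Fin 3)), u⟫ - a))) *
            ((‖v‖ ^ 2 + ((a - ⟪x₀, u⟫) + n * (-⟪γ, u⟫) +
                  (⟪(q : EuclideanSpace ℝ (Fin 3)), u⟫ - a)) ^ 2) ^ (-(4 : ℝ)) -
              (‖v‖ ^ 2 + ((a - ⟪x₀, u⟫) + n * (-⟪γ, u⟫) +
                  (⟪(q : EuclideanSpace ℝ (Fin 3)), u⟫ - a)) ^ 2) ^ (-(7 : ℝ))) : ℝ) : ℂ) := by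
        funext v
        rw [hPu, huu, neg_sq]
        simp
      rw [hfun]
      by_cases hk : k = 0
      · rw [if_pos hk, hk, hbl_dualVec_zero, hbl_fourier_verticalSlice_zero hV ht]
      · have hw : dualVec Λ k ≠ 0 := fun h0 => (hρ k hk).ne' (by rw [h0, norm_zero])
        rw [if_neg hk, hbl_fourier_verticalSlice hV ht hw]
    have hcov' : (((volume.real (fdom Λ)) : ℝ) : ℂ) ≠ 0 := by exact_mod_cast hcov
    rw [hchar]
    simp_rw [hterm]
    simp only [← mul_assoc]
    rw [Complex.ofReal_inv, mul_inv_cancel₀ hcov', one_mul]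
    ring
  have core := hbl_fibres_eq_zero_of_modeMoments' (0 : Fin (Module.finrank ℝ (ℝ ∙ u)ᗮ) → ℤ)
    (fun k => ‖dualVec Λ k‖) hρ0 hρ hfin hexp
    (fun k => echar Λ k ((ℝ ∙ u)ᗮ.orthogonalProjectionOnto γ))
    (fun k => echar Λ k ((ℝ ∙ u)ᗮ.orthogonalProjectionOnto x₀)) hχ hψ hinj
    (fun k (q : {q : EuclideanSpace ℝ (Fin 3) //
        q ∈ Dp ∪ Dm ∧ (ℝ ∙ u)ᗮ.orthogonalProjectionOnto q ∈ fdom Λ}) =>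
      (if ((q : EuclideanSpace ℝ (Fin 3)) ∈ Dp) then (1 : ℂ) else -1) *
      echar Λ (-k) ((ℝ ∙ u)ᗮ.orthogonalProjectionOnto (q : EuclideanSpace ℝ (Fin 3))))
    hθ hθ0 (fun q => ⟪(q : EuclideanSpace ℝ (Fin 3)), u⟫ - a) hy hN hh hX₀ hmom k (η - a)
  -- identify the fibre Finset with `T`
  have hTeq : T = Finset.filter
      (fun q : {q : EuclideanSpace ℝ (Fin 3) //
        q ∈ Dp ∪ Dm ∧ (ℝ ∙ u)ᗮ.orthogonalProjectionOnto q ∈ fdom Λ} =>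
        ⟪(q : EuclideanSpace ℝ (Fin 3)), u⟫ - a = η - a)
      (hbl_shell_heights_finite hN hy (η - a)).toFinset := by
    ext q
    rw [hT q, Finset.mem_filter, Set.Finite.mem_toFinset, Set.mem_setOf_eq]
    constructor
    · intro h
      exact ⟨by rw [h], by rw [h]⟩
    · intro h
      linarith [h.2]
  rw [hTeq]
  exact core

end Glue

/-- **Arithmetic observers kill every fibre of every mode** (registered `∀`-form of
`hbl_fibres_eq_zero_of_arith_observers'`; the disjointness hypothesis is not needed). [folklore] -/
theorem hbl_fibres_eq_zero_of_arith_observers : ∀ {u : EuclideanSpace ℝ (Fin 3)} (hu : ‖u‖ = 1) (Λ : Submodule ℤ (ℝ ∙ u)ᗮ) [DiscreteTopology Λ] [IsZLattice ℝ Λ] {Dp Dm : Set (EuclideanSpace ℝ (Fin 3))} {δ a : ℝ} (hδ : 0 < δ), Disjoint Dp Dm → (∀ x ∈ Dp, ∀ y ∈ Dp, x ≠ y → δ ≤ dist x y) → (∀ x ∈ Dm, ∀ y ∈ Dm, x ≠ y → δ ≤ dist x y) → (∀ y ∈ Dp, a ≤ inner ℝ y u) → (∀ y ∈ Dm, a ≤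 inner ℝ y u) → (∀ ℓ : Λ, ∀ y : EuclideanSpace ℝ (Fin 3), y + ((ℓ : (ℝ ∙ u)ᗮ) : EuclideanSpace ℝ (Fin 3)) ∈ Dp ↔ y ∈ Dp) → (∀ ℓ : Λ, ∀ y : EuclideanSpace ℝ (Fin 3), y + ((ℓ : (ℝ ∙ u)ᗮ) : EuclideanSpace ℝ (Fin 3)) ∈ Dm ↔ y ∈ Dm) → ∀ (x₀ γ : EuclideanSpace ℝ (Fin 3)), inner ℝ x₀ u < a → inner ℝ γ u < 0 → (Function.Injective fun k : Fin (Module.finrank ℝ (ℝ ∙ u)ᗮ) → ℤ => Literature.Algebra.EuclideanLattices.LatticePeriodic.echar Λ k ((ℝ ∙ u)ᗮ.orthogonalProjectionOnto γ)) → (∀ n : ℕ, (∑' yy : ↥(Dp ∪ Dm), (if (yy : EuclideanSpace ℝ (Fin 3)) ∈ Dp then (1 : ℂ) else -1) * ((inner ℝ u (((((‖(x₀ + (n : ℝ) • γ) - (yy : EuclideanSpace ℝ (Fin 3))‖ ^ 2) ^ 4)⁻¹ - ((‖(x₀ + (n : ℝ) • γ) - (yy : EuclideanSpace ℝ (Fin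 3))‖ ^ 2) ^ 7)⁻¹) • ((x₀ + (n : ℝ) • γ) - (yy : EuclideanSpace ℝ (Fin 3))))) : ℝ) : ℂ)) = 0) → ∀ (k : Fin (Module.finrank ℝ (ℝ ∙ u)ᗮ) → ℤ) (η : ℝ) (T : Finset {q : EuclideanSpace ℝ (Fin 3) // q ∈ Dp ∪ Dm ∧ (ℝ ∙ u)ᗮ.orthogonalProjectionOnto q ∈ Literature.Algebra.EuclideanLattices.LatticePeriodic.fdom Λ}), (∀ q, q ∈ T ↔ inner ℝ (q : EuclideanSpace ℝ (Fin 3)) u = η) → ∑ q ∈ T, (if ((q : EuclideanSpace ℝ (Fin 3)) ∈ Dp) then (1 : ℂ) else -1) * Literature.Algebra.EuclideanLattices.LatticePeriodic.echar Λ (-k) ((ℝ ∙ u)ᗮ.orthogonalProjectionOnto (q : EuclideanSpace ℝ (Fin 3))) = 0 := by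
  intro u hu Λ _ _ Dp Dm δ a hδ _ hsepp hsepm hap ham hDp hDm x₀ γ hx₀ hγ hinj hobs
  exact hbl_fibres_eq_zero_of_arith_observers' hu Λ hδ hsepp hsepm hap ham hDp hDm x₀ γ hx₀ hγ
    hinj hobs

end Summit.AtomisticToContinuum.Crystallization.Theorems.HolmgrenBoyleLind

end
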